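import Literature.AlgebraicGeometry.AbelianSchemes.HomFactorsThroughMulNLocus
import Literature.AlgebraicGeometry.AbelianSchemes.AbelianSchemeBaseChangeComp
import Literature.AlgebraicGeometry.AbelianSchemes.RigidifiedLineBundleComap
import Literature.AlgebraicGeometry.AbelianSchemes.AbelianSchemeOverFibreIdentity
import Literature.AlgebraicGeometry.AbelianSchemes.PolarizedAbelianSchemeWithLevel
import HarnessLib

/-!
# The homomorphism descended through `[N]` is compatible with base change
# ([MumfordFogartyKirwan1994] Ch. 6 §2, proof of Prop. 6.11: «(similarly, after any base extension `T → S`)»)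

Layer `Literature/AlgebraicGeometry/AbelianSchemes`, namespace `Literature.AlgebraicGeometry.AbelianSchemes.AbelianSchemeOver`.
THEOREMS ONLY (no definition, no named fact, no instance, no notation, no `sorry`).  Cell `hodgecm-mathlib` (D-0151), F-DAG row
F-2 (e) «MFK Prop. 6.11», sequel to ★ `HomFactorsThroughMulNLocus` (B2) for the locus assembly B3c (B-p17 (g12)).  HC_CM is proved
only modulo the 7 printed citations until rung 0 closes; nothing here is about HC.

For `S`-abelian schemes `A`, `B`, an `S`-morphism `φ : A → B`, `g : S′ ⟶ S`, `f′ : T ⟶ S′`, Mathlib's two base changes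
`A_{f′ ≫ g} = A.baseChange (f′ ≫ g)` and `(A_{S′})_T = (A.baseChange g).baseChange f′` are isomorphic AS GROUP SCHEMES (★
`baseChangeCompGrpIso`), and `A.restrictLeft g f′ : A_{f′ ≫ g} → A_{S′}` (★ `RigidifiedLineBundleComap`) is «`1_A × f′`».  For a
`T`-... resp. `S′`-homomorphism `ν : A_{S′} → B_{S′}` its TRANSPORT to `A_{f′ ≫ g} → B_{f′ ≫ g}` is
`νT := e_A ≫ (Over.pullback f′).map ν ≫ e_B⁻¹`:

* §1 (private) `[N] ≫ h = h ≫ [N]` for a homomorphism `h`, `pullback_map_pow_id`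
  (`(Over.pullback f).map [N] = [N]` for the transported group structure), `pow_left_eq` (`(ν ^ k).left = ν.left ≫ [k].left`);
* §2 **`transport_isMonHom`**, **`pow_id_comp_transport`** (if `[N] ≫ ν = φ_{S′}` then `[N] ≫ νT = φ_{f′ ≫ g}` — naturality of
  `Over.pullbackComp`), **`transport_left_comp_restrictLeft`** (`νT ≫ (1_B × f′) = (1_A × f′) ≫ ν` on underlying schemes),
  `transport_pow_left_comp_restrictLeft` (the same for `νT ^ k`, `ν ^ k`);
* §3 **`pow_left_comp_restrictLeft_of_pow_id_comp_eq`** — CONSEQUENCE WITH B2's uniqueness: if `m` over `S′` and `m′` over `T`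
  both descend `φ` through `[N]` (`[N] ≫ μ = φ_{S′}`, `[N] ≫ μ′ = φ_{f′ ≫ g}`, `N` invertible on `T`), then
  `(μ′ ^ k).left ≫ (1_B × f′) = (1_A × f′) ≫ (μ ^ k).left` — «the descended `μ` base-changes».

## References
* [MumfordFogartyKirwan1994] D. Mumford, J. Fogarty, F. Kirwan, *Geometric Invariant Theory*, 3rd ed. (1994), Ch. 6 §2
  Prop. 6.11 (p. 122; proof pp. 122–123); Ch. 7 §2 Definition 7.2 (p. 129).
* [GortzWedhorn2020] U. Görtz, T. Wedhorn, *Algebraic Geometry I*, 2nd ed. (2020), Section (4.7) (pp. 107–108), Prop. 4.16.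
-/

set_option backward.isDefEq.respectTransparency false

noncomputable section

open CategoryTheory CategoryTheory.Limits AlgebraicGeometry MonoidalCategory CartesianMonoidalCategory
open scoped MonObj CategoryTheory.Obj

universe u

namespace Literature.AlgebraicGeometry.AbelianSchemes

namespace AbelianSchemeOver

variable {S S' T : Scheme.{u}} (A : AbelianSchemeOver S) {B : AbelianSchemeOver S} (φ : A.X ⟶ B.X)
  (g : S' ⟶ S) (f' : T ⟶ S')

/-! ## §1 Plumbing: `[N]` and homomorphisms, `[N]` under `Over.pullback`, powers on underlying schemes -/

/-- `[N] ≫ h = h ≫ [N]` for a homomorphism `h` of group objects (`(𝟙)^N ≫ h = (𝟙 ≫ h)^N = (h ≫ 𝟙)^N = h ≫ (𝟙)^N`);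
generic private copy of ★ `HomKernelTorsionCount.pow_id_comp_eq_comp_pow_id` (stated there for abelian-scheme homomorphisms).
[cite: MumfordFogartyKirwan1994, Ch. 6 §1 (p. 115)] -/
private theorem pow_id_comp_eq_comp_pow_id_of_isMonHom {C : Type*} [Category C] [CartesianMonoidalCategory C] {X Y : C} [MonObj X] [MonObj Y]
    (h : X ⟶ Y) [IsMonHom h] (N : ℕ) : ((𝟙 X) ^ N) ≫ h = h ≫ ((𝟙 Y) ^ N) := by
  rw [MonObj.pow_comp, Category.id_comp, MonObj.comp_pow, Category.comp_id]

/-- `(Over.pullback f′).map [N]_{A′} = [N]_{A′_{T}}` for the group structure transported along `Over.pullback f′` (`Functor.map`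
of a monoidal functor is multiplicative, Mathlib `Functor.map_mul` / `map_one`). [cite: GortzWedhorn2020, Section (4.7) (pp. 107–108)] -/
theorem pullback_map_pow_id (A' : AbelianSchemeOver S') (N : ℕ) :
    (Over.pullback f').map ((𝟙 A'.X) ^ N) = (𝟙 (A'.baseChange f').X) ^ N := by
  induction N with
  | zero =>
    rw [pow_zero, pow_zero]
    exact Functor.map_one _
  | succ n ih =>
    rw [pow_succ, pow_succ]
    refine (Functor.map_mul _ _ _).trans ?_
    rw [ih, CategoryTheory.Functor.map_id]
    rfl

/-- `(ν ^ k).left = ν.left ≫ [k].left` on underlying schemes (`ν ^ k = ν ≫ (𝟙)^k`, Mathlib `MonObj.comp_pow`).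
[cite: MumfordFogartyKirwan1994, Ch. 6 §1 (p. 115)] -/
theorem pow_left_eq {T : Scheme.{u}} {A' B' : AbelianSchemeOver T} (ν : A'.X ⟶ B'.X) (k : ℕ) :
    (ν ^ k).left = ν.left ≫ (((𝟙 B'.X : B'.X ⟶ B'.X) ^ k) : B'.X ⟶ B'.X).left := by
  rw [← Over.comp_left, MonObj.comp_pow, Category.comp_id]

/-- `A.restrictLeft g f′ = (1_A × f′) : A_{f′ ≫ g} → A_{S′}` is the underlying map of a base-change square of GROUP schemes
over `𝟙 T ≫ f′` (the group-scheme isomorphism ★ `baseChangeCompGrpIso` over `T`, then the chosen base change of `A_{S′}` along `f′`;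
★ `IsBaseChangeVia.trans`). [cite: MumfordFogartyKirwan1994, Ch. 7 §2 Definition 7.2 (p. 129)] [cite: GortzWedhorn2020, Section (4.7) (pp. 107–108)] -/
theorem isBaseChangeVia_restrictLeft :
    (A.baseChange (f' ≫ g)).IsBaseChangeVia (A.baseChange g) (𝟙 T ≫ f') (A.restrictLeft g f') := by
  have h1 : (A.baseChange (f' ≫ g)).IsBaseChangeVia ((A.baseChange g).baseChange f') (𝟙 T)
      (A.baseChangeCompGrpIso g f').hom.hom.hom.left :=
    isBaseChangeVia_id_of_isMonHom _ _ (A.baseChangeCompGrpIso g f').hom.hom.hom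
  exact h1.trans ((A.baseChange g).baseChange_isBaseChangeVia f')

/-! ## §2 The transport of a homomorphism along `baseChangeCompGrpIso` -/

section Transport

variable {A} (ν : (A.baseChange g).X ⟶ (B.baseChange g).X)

/-- **The transport `νT = e_A ≫ ν_T ≫ e_B⁻¹` is a homomorphism** when `ν` is. [cite: GortzWedhorn2020, Section (4.7) (pp. 107–108)] -/
theorem transport_isMonHom [IsMonHom ν] :
    IsMonHom ((A.baseChangeCompGrpIso g f').hom.hom.hom ≫ (Over.pullback f').map ν ≫
      (B.baseChangeCompGrpIso g f').inv.hom.hom) := by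
  infer_instance

/-- **The transport descends `φ` when `ν` does**: if `[N] ≫ ν = φ_{S′}` then `[N] ≫ νT = φ_{f′ ≫ g}` (the transport isomorphisms
are homomorphisms, `Over.pullback f′` maps `[N]` to `[N]`, and `Over.pullbackComp` is natural in `φ`).
[cite: MumfordFogartyKirwan1994, Ch. 6 §2 Prop. 6.11 (p. 122; proof pp. 122–123)] [cite: GortzWedhorn2020, Section (4.7) (pp. 107–108)] -/
theorem pow_id_comp_transport {N : ℕ}
    (hν : ((𝟙 (A.baseChange g).X) ^ N) ≫ ν = (Over.pullback g).map φ) :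
    ((𝟙 (A.baseChange (f' ≫ g)).X) ^ N) ≫ ((A.baseChangeCompGrpIso g f').hom.hom.hom ≫ (Over.pullback f').map ν ≫
        (B.baseChangeCompGrpIso g f').inv.hom.hom) = (Over.pullback (f' ≫ g)).map φ := by
  have hnat : (Over.pullback (f' ≫ g)).map φ ≫ (B.baseChangeCompGrpIso g f').hom.hom.hom =
      (A.baseChangeCompGrpIso g f').hom.hom.hom ≫ (Over.pullback f').map ((Over.pullback g).map φ) := by
    rw [A.baseChangeCompGrpIso_hom_hom_hom g f', B.baseChangeCompGrpIso_hom_hom_hom g f']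
    exact (Over.pullbackComp f' g).hom.naturality φ
  have hinv : (B.baseChangeCompGrpIso g f').hom.hom.hom ≫ (B.baseChangeCompGrpIso g f').inv.hom.hom =
      𝟙 (B.baseChange (f' ≫ g)).X := by
    change ((B.baseChangeCompGrpIso g f').hom ≫ (B.baseChangeCompGrpIso g f').inv).hom.hom = _
    rw [Iso.hom_inv_id]
    rfl
  rw [← Category.assoc, pow_id_comp_eq_comp_pow_id_of_isMonHom, Category.assoc,
    ← Category.assoc ((𝟙 ((A.baseChange g).baseChange f').X) ^ N),
    show ((𝟙 ((A.baseChange g).baseChange f').X) ^ N) = (Over.pullback f').map ((𝟙 (A.baseChange g).X) ^ N) from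
      (pullback_map_pow_id f' (A.baseChange g) N).symm,
    ← Functor.map_comp, hν, ← Category.assoc, ← hnat, Category.assoc, hinv]
  exact Category.comp_id _

/-- **The transport restricts to `ν` along `1 × f′`**: `νT.left ≫ (1_B × f′) = (1_A × f′) ≫ ν.left` (★ `Limits.pullback_map_left_comp_fst`,
★ `baseChangeCompGrpIso_inv_left_hom_left`). [cite: GortzWedhorn2020, Section (4.7) (pp. 107–108)] -/
theorem transport_left_comp_restrictLeft :
    ((A.baseChangeCompGrpIso g f').hom.hom.hom ≫ (Over.pullback f').map ν ≫
        (B.baseChangeCompGrpIso g f').inv.hom.hom).left ≫ B.restrictLeft g f' =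
      A.restrictLeft g f' ≫ ν.left := by
  rw [Over.comp_left, Over.comp_left]
  change ((A.baseChangeCompGrpIso g f').hom.hom.hom.left ≫ ((Over.pullback f').map ν).left ≫
      (B.baseChangeCompGrpIso g f').inv.hom.hom.left) ≫ (B.baseChangeCompGrpIso g f').hom.hom.hom.left ≫
        pullback.fst (pullback.snd B.X.hom g) f' =
    ((A.baseChangeCompGrpIso g f').hom.hom.hom.left ≫ pullback.fst (pullback.snd A.X.hom g) f') ≫ ν.left
  rw [Category.assoc, Category.assoc, B.baseChangeCompGrpIso_inv_left_hom_left_assoc g f', Category.assoc]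
  exact congrArg _ (Limits.pullback_map_left_comp_fst f' ν)

/-- The same for powers: `(νT ^ k).left ≫ (1_B × f′) = (1_A × f′) ≫ (ν ^ k).left` (`[k]` commutes with `1 × f′`, ★
`IsBaseChangeVia.pow_id_left_comp` for `isBaseChangeVia_restrictLeft`). [cite: GortzWedhorn2020, Section (4.7) (pp. 107–108)] -/
theorem transport_pow_left_comp_restrictLeft (k : ℕ) :
    (((A.baseChangeCompGrpIso g f').hom.hom.hom ≫ (Over.pullback f').map ν ≫
        (B.baseChangeCompGrpIso g f').inv.hom.hom) ^ k).left ≫ B.restrictLeft g f' =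
      A.restrictLeft g f' ≫ (ν ^ k).left := by
  rw [pow_left_eq ν k, pow_left_eq ((A.baseChangeCompGrpIso g f').hom.hom.hom ≫ (Over.pullback f').map ν ≫
      (B.baseChangeCompGrpIso g f').inv.hom.hom) k, Category.assoc, (B.isBaseChangeVia_restrictLeft g f').pow_id_left_comp k,
    ← Category.assoc, transport_left_comp_restrictLeft, Category.assoc]

end Transport

/-! ## §3 The descended homomorphism base-changes -/

/-- **«The descended `μ` base-changes»** ([MumfordFogartyKirwan1994] proof of Prop. 6.11, «similarly, after any base extension»):
if `μ : A_{S′} → B_{S′}` descends `φ_{S′}` through `[N]` and `μ′ : A_{f′ ≫ g} → B_{f′ ≫ g}` descends `φ_{f′ ≫ g}` through `[N]`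
(`N` invertible in the residue fields of `T`), then `μ′` IS the transport of `μ` (uniqueness of the descent through the epimorphism
`[N]`, ★ `existsUnique`-half of B2) and hence `(μ′ ^ k) ≫ (1_B × f′) = (1_A × f′) ≫ (μ ^ k)` on underlying schemes for every `k`.
[cite: MumfordFogartyKirwan1994, Ch. 6 §2 Prop. 6.11 (p. 122; proof pp. 122–123)] [cite: GortzWedhorn2020, Section (4.7) (pp. 107–108)] -/
theorem pow_left_comp_restrictLeft_of_pow_id_comp_eq {N : ℕ}
    (hN : ∀ t : T, (N : T.residueField t) ≠ 0)
    (m : (A.baseChange g).X ⟶ (B.baseChange g).X) (hm : ((𝟙 (A.baseChange g).X) ^ N) ≫ m = (Over.pullback g).map φ)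
    (m' : (A.baseChange (f' ≫ g)).X ⟶ (B.baseChange (f' ≫ g)).X)
    (hm' : ((𝟙 (A.baseChange (f' ≫ g)).X) ^ N) ≫ m' = (Over.pullback (f' ≫ g)).map φ) (k : ℕ) :
    (m' ^ k).left ≫ B.restrictLeft g f' = A.restrictLeft g f' ≫ (m ^ k).left := by
  -- `m′` is the transport of `m`: both descend `φ_{f′ ≫ g}` through the epimorphism `[N]`
  have hT := pow_id_comp_transport φ g f' m hm (N := N)
  haveI := (A.baseChange (f' ≫ g)).flat_pow_id_left hN
  haveI := (A.baseChange (f' ≫ g)).surjective_pow_id_left hN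
  haveI : QuasiCompact ((((𝟙 (A.baseChange (f' ≫ g)).X : _ ⟶ _) ^ N) : _ ⟶ _).left) := by
    haveI := (A.baseChange (f' ≫ g)).isProper_pow_id_left N
    infer_instance
  have heq : m' = (A.baseChangeCompGrpIso g f').hom.hom.hom ≫ (Over.pullback f').map m ≫
      (B.baseChangeCompGrpIso g f').inv.hom.hom := by
    apply Over.OverMorphism.ext
    rw [← cancel_epi ((((𝟙 (A.baseChange (f' ≫ g)).X : _ ⟶ _) ^ N) : _ ⟶ _).left), ← Over.comp_left, ← Over.comp_left,
      hm', hT]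
  rw [heq]
  exact transport_pow_left_comp_restrictLeft g f' m k

end AbelianSchemeOver

end Literature.AlgebraicGeometry.AbelianSchemes

end
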